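import Summits.CriticalPhenomena.SAWScalingLimit.Theorems.SAWDevelopingMapHexConjectureAvoidanceCocycle
import Summits.CriticalPhenomena.SAWScalingLimit.Theorems.SAWChargeContinuationSAWAvoidanceLawOfScalingLimit
import HarnessLib

/-!
# Crux `HexConjecture` (stmt-CriticalPhenomena-0808), line `root-locality-replaces-loewner`:
THE AVOIDANCE COCYCLE IS NECESSARY (crux ⟹ statement 3's conclusion, on EVERY Dobrushin domain)

Landing target:
`Summits/CriticalPhenomena/SAWScalingLimit/Theorems/SAWDevelopingMapHexConjectureCocycleNecessity.lean`
(`--supports stmt-CriticalPhenomena-0808`; lead continuation prover-line-stmt-CriticalPhenomena-0808-c1-0).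

`hexAvoidanceCocycle_of_hexConjecture`: IF the critical hexagonal SAW converges in law to chordal SLE(8/3) in `(D; a, b)`
(the crux, at one marked domain and one endpoint approximation), THEN for every hull subdomain `D'` of `D` and every
chordal SLE(8/3) law `μ` of `D` the probabilities of the CLOSED curve-space events `{range γ_δ ⊆ cl D'}` converge to
`μ {range ⊆ cl D'}` — the avoidance cocycle with its Lawler–Schramm–Werner value, i.e. the conclusion of this line's
statements 3 / 3♭ / 3♯ (`HexAvoidanceCocycle`, `HexAvoidanceCocycleFloor`), with no flatness, floor or boundary-endpoint
hypothesis at all.  Hence the cocycle — the output of either lever — is irrefutable short of refuting the crux, exactly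
like non-retracing (`nonRetracingFloor_of_hexConjecture`) and the floor class itself (`hexConjectureFloor_of_hexConjecture`).

Proof: portmanteau.  The pushed-forward SAW laws `ν_δ` are eventually probability measures and converge weakly to the SLE
law `μ₀ = law Γ`; for the closed event `E = {range ⊆ cl D'}` and the open event `O = {range misses cl (D ∖ D')}` one has
`ν_δ O ≤ ν_δ E` (a lattice polyline lies in `cl D`, and `cl D ∖ cl (D ∖ D') ⊆ cl D'`) and `μ₀ (E ∖ O) = 0` (the SLE(8/3)
trace in `cl D'` touches `∂D' ∖ {a, b}` with probability zero: `MutualAvoidanceLaw.sle_measure_diff_avoid_eq_zero`, [LSW]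
Thm. 6.1 + Rohde–Schramm); the three-term sandwich `SAWChargeContinuation.tendsto_of_sandwich` gives `ν_δ E → μ₀ E`, and
`μ₀ E = μ E = Φ_A'(0)^{5/8}` for every SLE(8/3) law `μ` of `D` (`measure_rangeSubset_closure_eq_of_isSLELaw`).
-/

noncomputable section

open scoped Topology NNReal ENNReal BoundedContinuousFunction
open Filter Set Metric MeasureTheory
open Literature.Probability.LatticeModels (HexVertex hexGraph hexCenter)
open Literature.Probability
open Literature.Probability.RandomPlanarGeometry
open Literature.Probability.RandomPlanarGeometry.SAW
open UpperHalfPlane (upperHalfPlaneSet)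
open Summit.CriticalPhenomena.SAWScalingLimit.Theorems.ObservableToSLE.FloorRatio
  (curve_mem_rangeSubset_of_meshWalk eventually_ne_of_tendsto_hexCenter)
open Summit.CriticalPhenomena.SAWScalingLimit.Theorems.ObservableToSLE.Negative
  (eventually_isProbabilityMeasure_hexSAWLaw)
open Summit.CriticalPhenomena.SAWScalingLimit.Theorems.HexConjecture.RootLocality.Cocycle
  (measure_rangeSubset_closure_eq_of_isSLELaw)
open Summit.CriticalPhenomena.SAWScalingLimit.Theorems.SAWChargeContinuation (tendsto_of_sandwich)
open Summit.CriticalPhenomena.SAWScalingLimit.Theorems.MutualAvoidanceLaw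
  (sle_measure_diff_avoid_eq_zero mem_rangeSubset_closure_of_avoid)

namespace Summit.CriticalPhenomena.SAWScalingLimit.Theorems.HexConjecture.RootLocality

/-- A lattice polyline of `Ω_δ` (with distinct endpoints) lies in `closure Ω`. [folklore] -/
theorem curve_mem_rangeSubset_closure {Ω : Set ℂ} {δ : ℝ} {u v : HexVertex} (huv : u ≠ v)
    (γ : HexDomainSAW Ω δ u v) : γ.curve ∈ CurveClass.rangeSubset (closure Ω) :=
  curve_mem_rangeSubset_of_meshWalk γ
    (fun w hw => embMeshDomain_subset _ _ _ _ (support_subset_embMeshDomain_of_ne γ huv w hw))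
    (fun e _ => ((embDomainGraph_adj_iff _ _).1 e.adj).1)

/-- **The avoidance cocycle is necessary.**  Convergence in law of the critical hexagonal SAW of `(D; a, b)` to chordal
SLE(8/3) (the crux at one marked domain and one endpoint approximation) implies, for every hull subdomain `D'` and every
chordal SLE(8/3) law `μ` of `D`, `P_δ[range γ_δ ⊆ cl D'] → μ {range ⊆ cl D'}` — by the portmanteau sandwich between the
closed event `{range ⊆ cl D'}` and the open event `{range misses cl (D ∖ D')}`, which differ by a `μ`-null set.
[cite: LawlerSchrammWerner2003Restriction, Thm. 6.1 (p. 23); portmanteau: Billingsley 1999 Thm. 2.1] -/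
theorem tendsto_rangeSubset_of_convergesInLawToSLE {D D' : DobrushinDomain} {a b : ℝ → HexVertex}
    (hab : IsEmbEndpointApprox hexGraph hexCenter D a b)
    (hconv : ConvergesInLawToSLE ((8 : ℝ≥0) / 3) D
      (fun δ (γ : HexDomainSAW D.carrier δ (a δ) (b δ)) => γ.curve)
      (fun δ => hexSAWLaw D.carrier δ (a δ) (b δ)))
    (hD' : D.IsHullSubdomain D') {μ : Measure (CurveClass ℂ)} (hμ : IsSLELaw ((8 : ℝ≥0) / 3) D μ) :
    Tendsto (fun δ : ℝ =>
        ((hexSAWLaw D.carrier δ (a δ) (b δ)).map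
            (fun γ : HexDomainSAW D.carrier δ (a δ) (b δ) => γ.curve))
          (CurveClass.rangeSubset (closure D'.carrier)))
      (𝓝[>] 0) (𝓝 (μ (CurveClass.rangeSubset (closure D'.carrier)))) := by
  classical
  haveI : Fact Process.isProjectiveLimit_preWienerMeasure := ⟨isProjectiveLimit_preWienerMeasure_holds⟩
  -- the scaling limit: an SLE(8/3) curve `Γ` and its law `μ₀`
  obtain ⟨Γ, hΓ, -, hT⟩ := hconv
  set μ₀ : Measure (CurveClass ℂ) := Process.preWienerMeasure.map Γ with hμ₀def
  have hμ₀ : IsSLELaw ((8 : ℝ≥0) / 3) D μ₀ := ⟨Γ, hΓ, rfl⟩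
  haveI : IsProbabilityMeasure μ₀ := hμ₀.isProbabilityMeasure
  -- the value is the same for every SLE(8/3) law of `D`
  obtain ⟨φ, Φ, d, hφ, hΦ, hd, -, -⟩ := stub_avoidanceCocycle_restrictionData D D' hD'
  rw [measure_rangeSubset_closure_eq_of_isSLELaw hμ hD' hφ hΦ hd,
    ← measure_rangeSubset_closure_eq_of_isSLELaw hμ₀ hD' hφ hΦ hd]
  -- the pushed-forward SAW laws converge weakly to `μ₀`
  set ν : ℝ → Measure (CurveClass ℂ) := fun δ =>
    (hexSAWLaw D.carrier δ (a δ) (b δ)).map (fun γ : HexDomainSAW D.carrier δ (a δ) (b δ) => γ.curve)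
    with hν
  have hprob : ∀ᶠ δ in 𝓝[>] (0 : ℝ), IsProbabilityMeasure (ν δ) := by
    filter_upwards [eventually_isProbabilityMeasure_hexSAWLaw hab] with δ hδ
    exact Measure.isProbabilityMeasure_map (EmbDomainSAW.measurable_of_top _).aemeasurable
  have hlim : ∀ f : CurveClass ℂ →ᵇ ℝ,
      Tendsto (fun δ => ∫ x, f x ∂ν δ) (𝓝[>] (0 : ℝ)) (𝓝 (∫ x, f x ∂μ₀)) := by
    intro f
    have h : Tendsto (fun δ => ∫ γ, f γ.curve ∂(hexSAWLaw D.carrier δ (a δ) (b δ))) (𝓝[>] (0 : ℝ))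
        (𝓝 (∫ ω, f (Γ ω) ∂Process.preWienerMeasure)) := hT f
    rw [hμ₀def, integral_map hΓ.aemeasurable f.continuous.aestronglyMeasurable]
    refine h.congr' (Eventually.of_forall fun δ => ?_)
    exact (integral_map (EmbDomainSAW.measurable_of_top _).aemeasurable
      f.continuous.aestronglyMeasurable).symm
  -- the closed and the open event, equal under `μ₀` up to a null set
  set E : Set (CurveClass ℂ) := CurveClass.rangeSubset (closure D'.carrier) with hE
  set O : Set (CurveClass ℂ) := CurveClass.rangeSubset (closure (D.carrier \ D'.carrier))ᶜ with hO
  have hEc : IsClosed E := CurveClass.isClosed_rangeSubset isClosed_closure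
  have hOo : IsOpen O := CurveClass.isOpen_rangeSubset isClosed_closure.isOpen_compl
  have hnull : μ₀ (E \ O) = 0 := sle_measure_diff_avoid_eq_zero hD' hμ₀
  -- the lattice side: a polyline of `Ω_δ` missing `cl (D ∖ D')` lies in `cl D'`
  have hne : ∀ᶠ δ : ℝ in 𝓝[>] 0, a δ ≠ b δ :=
    eventually_ne_of_tendsto_hexCenter (D.pt_injective.ne (by decide)) hab.tendsto_fst hab.tendsto_snd
  have hOp : ∀ᶠ δ in 𝓝[>] (0 : ℝ), ν δ O ≤ ν δ E := by
    filter_upwards [hne] with δ hδ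
    simp only [hν]
    rw [Measure.map_apply (EmbDomainSAW.measurable_of_top _) hOo.measurableSet,
      Measure.map_apply (EmbDomainSAW.measurable_of_top _) hEc.measurableSet]
    refine measure_mono fun γ hγ => ?_
    have hD : γ.curve.range ⊆ closure D.carrier := by
      have h := curve_mem_rangeSubset_closure hδ γ
      rwa [CurveClass.mem_rangeSubset] at h
    exact mem_rangeSubset_closure_of_avoid hD'.carrier_subset hD hγ
  -- the sandwich
  have hlimit := tendsto_of_sandwich hprob hlim hEc hOo hnull (fun δ => ν δ E) hOp
    (Eventually.of_forall fun δ => le_rfl)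
  simpa only [hν, hE] using hlimit

/-- **The crux implies the FLOOR-class avoidance cocycle** (`HexConjecture → HexAvoidanceCocycleFloor`, the conclusion of the
skeleton's statements 3♭ / 3♯ / 3♯♯): so the output of either lever of the line is not a strengthening of the crux. [folklore] -/
theorem hexAvoidanceCocycleFloor_of_hexConjecture
    (h : Summit.CriticalPhenomena.SAWScalingLimit.Theses.SAWDevelopingMap.HexConjecture) :
    ∀ (D D' : DobrushinDomain) (ρ : ℝ) (a b : ℝ → HexVertex) (μ : Measure (CurveClass ℂ)),
      (0 < ρ ∧ (D.pt 1).im = (D.pt 0).im ∧ D.carrier ⊆ {z : ℂ | (D.pt 0).im < z.im} ∧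
        D.carrier ∩ ball (D.pt 0) ρ = {z : ℂ | (D.pt 0).im < z.im} ∩ ball (D.pt 0) ρ ∧
        D.carrier ∩ ball (D.pt 1) ρ = {z : ℂ | (D.pt 1).im < z.im} ∩ ball (D.pt 1) ρ) →
      IsEmbEndpointApprox hexGraph hexCenter D a b →
      (∀ᶠ δ : ℝ in 𝓝[>] 0,
        (a δ ∈ embMeshDomain hexGraph hexCenter D.carrier δ ∧
          ∃ w, hexGraph.Adj (a δ) w ∧ ¬ (hexDomainGraph D.carrier δ).Adj (a δ) w) ∧
        (b δ ∈ embMeshDomain hexGraph hexCenter D.carrier δ ∧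
          ∃ w, hexGraph.Adj (b δ) w ∧ ¬ (hexDomainGraph D.carrier δ).Adj (b δ) w)) →
      D.IsHullSubdomain D' → IsSLELaw ((8 : ℝ≥0) / 3) D μ →
      Tendsto (fun δ : ℝ =>
        ((hexSAWLaw D.carrier δ (a δ) (b δ)).map
            (fun γ : HexDomainSAW D.carrier δ (a δ) (b δ) => γ.curve))
          (CurveClass.rangeSubset (closure D'.carrier)))
        (𝓝[>] 0) (𝓝 (μ (CurveClass.rangeSubset (closure D'.carrier)))) :=
  fun D _ _ a b _ _ hab _ hD' hμ => tendsto_rangeSubset_of_convergesInLawToSLE hab (h D a b hab) hD' hμ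

/-- **The crux implies the FLAT-boundary-class avoidance cocycle** (`HexConjecture → HexAvoidanceCocycle`, the conclusion of the
original statement 3 of the line). [folklore] -/
theorem hexAvoidanceCocycle_of_hexConjecture
    (h : Summit.CriticalPhenomena.SAWScalingLimit.Theses.SAWDevelopingMap.HexConjecture) :
    ∀ (D D' : DobrushinDomain) (ρ : ℝ) (a b : ℝ → HexVertex) (μ : Measure (CurveClass ℂ)),
      0 < ρ →
      (∀ i : Fin 2, D.carrier ∩ ball (D.pt i) ρ = {z : ℂ | (D.pt i).im < z.im} ∩ ball (D.pt i) ρ) →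
      IsEmbEndpointApprox hexGraph hexCenter D a b →
      (∀ᶠ δ : ℝ in 𝓝[>] 0,
        (a δ ∈ embMeshDomain hexGraph hexCenter D.carrier δ ∧
          ∃ w, hexGraph.Adj (a δ) w ∧ ¬ (hexDomainGraph D.carrier δ).Adj (a δ) w) ∧
        (b δ ∈ embMeshDomain hexGraph hexCenter D.carrier δ ∧
          ∃ w, hexGraph.Adj (b δ) w ∧ ¬ (hexDomainGraph D.carrier δ).Adj (b δ) w)) →
      D.IsHullSubdomain D' → IsSLELaw ((8 : ℝ≥0) / 3) D μ →
      Tendsto (fun δ : ℝ =>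
        ((hexSAWLaw D.carrier δ (a δ) (b δ)).map
            (fun γ : HexDomainSAW D.carrier δ (a δ) (b δ) => γ.curve))
          (CurveClass.rangeSubset (closure D'.carrier)))
        (𝓝[>] 0) (𝓝 (μ (CurveClass.rangeSubset (closure D'.carrier)))) :=
  fun D _ _ a b _ _ _ hab _ hD' hμ => tendsto_rangeSubset_of_convergesInLawToSLE hab (h D a b hab) hD' hμ

end Summit.CriticalPhenomena.SAWScalingLimit.Theorems.HexConjecture.RootLocality

end
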